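import Literature.MathematicalPhysics.QuantumFieldTheory.Balaban1983to89.TreeLengthTorus

/-!
# NODE O port PT-A — `stub_G3C` helper (leaves (D)(α)(γ), any edition): SCHUR SUMS OF A SUM OF CUBE-SUPPORTED PIECES — if `T_Y` (domains `Y` of the torus catalogue `𝐃_j`) is supported on
# the indices whose cube lies in `Y` and has (weighted) Schur row∕column sums `≤ c₀·e^{−δ₀·d_j(Y)}`, then for `δ₀ ≥ kappa₀(4·2^d, 2d)` every partial sum `Σ_{Y ∈ S} T_Y` has (weighted) Schur
# sums `≤ c₀·K₀(4·2^d, 2d)` — uniformly in the volume and in the family `S` ((1.26) on the torus)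

Cell `ym-nodeO-ideate`, porter hand `hand-27930-G3C` (g0); proof kind, `--supports stmt-QuantumFields-27930 --as helper` (count-neutral).  [I] = [Balaban1987RG1], [II] = [Balaban1988RG2Cluster].

WHY.  The X-localized operators `T^{(Z)} = Σ_{Y ⊆ Z} T_Y` of a walk edition of [16] (63)'s resolvent member (the current `G3CAtRecord` or the repaired `G3CAtRecordL`, `G3C-OBSTRUCTION-v1.md` §5 (D))
must be bounded operators with constants independent of `Z`, of the volume and of `k`; with the P0-ℂ body's (P4) (and the hand's (P4-lat)) this is the animal bound (1.26): a row index `i`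
only sees the pieces `Y ∋ cube(i)`.  The weight `w i j ≥ 0` is arbitrary (`1` for (P4), `e^{δ₁·tdist}` for (P4-lat)), so ONE lemma feeds both ✓`…LocPowSeries.l2_opNorm_le_of_row_col_sum` (operator norm)
and ✓`…G3CCombesThomas` ∕ ✓`…G3CResolvent` (x-uniform Combes–Thomas of `x·1 + T^{(Z)}`).

WHAT THIS FILE PROVES (sorry-free; generic finite index type `ι` with a cube map `cub : ι → TPt d N`, pieces indexed by `(tsys d N).Dom` = the record's `(recordDomSys …).Dom`): `sum_exp_above_le`,
`sum_ite_mem_le`, `weightedRowSum_sum_pieces_le` (support in the ROW index) and `weightedColSum_sum_pieces_le` (support in the COLUMN index): `Σ_j ‖(Σ_{Y∈S} T_Y) i j‖·w i j ≤ c₀·K₀(4·2^d, 2d)`.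

HONEST FRAMING.  Elementary; nothing of Bałaban's asserted, ported or discharged; `stub_G3C` NOT closed (mis-cut verdict stands); 27930 OPEN; NODE O 0∕1; COUNT 8∕28 · K 1∕4 UNMOVED; finite `𝕋⁴`
at fixed ε — NOT continuum ∕ OS ∕ Clay; **the Yang–Mills mass gap is NOT proved by any of this.**  No `sorry`, no `instance`, no `notation`, no `def`; standard axioms.
-/

noncomputable section

open scoped BigOperators
open Finset

namespace Summit.QuantumFields.YangMills.Theorems.BalabanUVNodesPortS1.G3CGeom

open Literature.MathematicalPhysics.QuantumFieldTheory.Balaban1983to89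
open Literature.MathematicalPhysics.QuantumFieldTheory.Balaban1983to89.TreeLengthTorus
open Literature.MathematicalPhysics.QuantumFieldTheory.Balaban1983to89.B12TreeDecay (K₀ kappa₀ CubeSystem.mem_above)

variable {ι : Type*} [Fintype ι] {d N : ℕ} [NeZero N]

/-- (1.26) on the torus, indexed by the domain TYPE `(tsys d N).Dom` (the record's `(recordDomSys …).Dom`): `Σ_{Y ∈ 𝐃, Y ∋ c} e^{−δ·d_j(Y)} ≤ K₀` for `δ ≥ kappa₀`.
[cite: Balaban1988RG2Cluster, (1.26) p.8] -/
theorem sum_exp_above_le (c : TPt d N) {δ : ℝ} (hδ : kappa₀ (4 * 2 ^ d) (2 * d) ≤ δ) :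
    ∑ Y ∈ (tcubeSys d N).above c, Real.exp (-(δ * torusTreeLen Y.1)) ≤ K₀ (4 * 2 ^ d) (2 * d) := by
  have h := hTree_torus d N hδ c
  rw [B12TreeDecay.CubeSystem.toCubeCover_above] at h
  refine le_trans (le_of_eq (Finset.sum_congr rfl fun Y _ => ?_)) h
  rw [tsys_dj, neg_mul]

/-- The pieces seen by a row index: `Σ_{Y ∈ S} [c ∈ Y]·c₀e^{−δ₀ d_j(Y)} ≤ c₀·K₀`. [cite: Balaban1988RG2Cluster, (1.26) p.8] -/
theorem sum_ite_mem_le (c : TPt d N) {c₀ δ₀ : ℝ} (hc₀ : 0 ≤ c₀) (hδ₀ : kappa₀ (4 * 2 ^ d) (2 * d) ≤ δ₀) (S : Finset (tsys d N).Dom)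
    [DecidablePred fun Y : (tsys d N).Dom => c ∈ Y.1] :
    ∑ Y ∈ S, (if c ∈ Y.1 then c₀ * Real.exp (-(δ₀ * torusTreeLen Y.1)) else 0) ≤ c₀ * K₀ (4 * 2 ^ d) (2 * d) := by
  have hsub : S.filter (fun Y : (tsys d N).Dom => c ∈ Y.1) ⊆ (tcubeSys d N).above c := by
    intro Y hY
    rw [Finset.mem_filter] at hY
    rw [CubeSystem.mem_above, tcubeSys_cubes]
    exact hY.2
  calc ∑ Y ∈ S, (if c ∈ Y.1 then c₀ * Real.exp (-(δ₀ * torusTreeLen Y.1)) else 0)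
      = ∑ Y ∈ S.filter (fun Y : (tsys d N).Dom => c ∈ Y.1), c₀ * Real.exp (-(δ₀ * torusTreeLen Y.1)) := (Finset.sum_filter _ _).symm
    _ ≤ ∑ Y ∈ (tcubeSys d N).above c, c₀ * Real.exp (-(δ₀ * torusTreeLen Y.1)) :=
        Finset.sum_le_sum_of_subset_of_nonneg hsub fun _ _ _ => by positivity
    _ = c₀ * ∑ Y ∈ (tcubeSys d N).above c, Real.exp (-(δ₀ * torusTreeLen Y.1)) := by rw [Finset.mul_sum]
    _ ≤ c₀ * K₀ (4 * 2 ^ d) (2 * d) := mul_le_mul_of_nonneg_left (sum_exp_above_le c hδ₀) hc₀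

/-- **Weighted Schur ROW sums of a partial sum of cube-supported pieces** (support in the row index): `≤ c₀·K₀`, uniformly in `S` and the volume. [cite: Balaban1988RG2Cluster, (1.26) p.8; Balaban1987RG1, (1.18) p.263] -/
theorem weightedRowSum_sum_pieces_le (cub : ι → TPt d N) (T : (tsys d N).Dom → Matrix ι ι ℂ)
    (hsupp : ∀ (Y : (tsys d N).Dom) (i j : ι), cub i ∉ Y.1 → T Y i j = 0)
    (w : ι → ι → ℝ) (hw : ∀ i j, 0 ≤ w i j) {c₀ δ₀ : ℝ} (hc₀ : 0 ≤ c₀) (hδ₀ : kappa₀ (4 * 2 ^ d) (2 * d) ≤ δ₀)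
    (hrow : ∀ (Y : (tsys d N).Dom) (i : ι), ∑ j, ‖T Y i j‖ * w i j ≤ c₀ * Real.exp (-(δ₀ * torusTreeLen Y.1)))
    (S : Finset (tsys d N).Dom) (i : ι) :
    ∑ j, ‖(∑ Y ∈ S, T Y) i j‖ * w i j ≤ c₀ * K₀ (4 * 2 ^ d) (2 * d) := by
  classical
  calc ∑ j, ‖(∑ Y ∈ S, T Y) i j‖ * w i j
      ≤ ∑ j, (∑ Y ∈ S, ‖T Y i j‖) * w i j := by
        refine Finset.sum_le_sum fun j _ => mul_le_mul_of_nonneg_right ?_ (hw i j)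
        rw [Matrix.sum_apply]
        exact norm_sum_le _ _
    _ = ∑ Y ∈ S, ∑ j, ‖T Y i j‖ * w i j := by
        rw [Finset.sum_comm]; exact Finset.sum_congr rfl fun j _ => Finset.sum_mul _ _ _
    _ ≤ ∑ Y ∈ S, (if cub i ∈ Y.1 then c₀ * Real.exp (-(δ₀ * torusTreeLen Y.1)) else 0) := by
        refine Finset.sum_le_sum fun Y _ => ?_
        split_ifs with h
        · exact hrow Y i
        · rw [Finset.sum_eq_zero fun j _ => by rw [hsupp Y i j h, norm_zero, zero_mul]]
    _ ≤ c₀ * K₀ (4 * 2 ^ d) (2 * d) := sum_ite_mem_le (cub i) hc₀ hδ₀ S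

/-- **Weighted Schur COLUMN sums of a partial sum of cube-supported pieces** (support in the column index): `≤ c₀·K₀`. [cite: Balaban1988RG2Cluster, (1.26) p.8; Balaban1987RG1, (1.18) p.263] -/
theorem weightedColSum_sum_pieces_le (cub : ι → TPt d N) (T : (tsys d N).Dom → Matrix ι ι ℂ)
    (hsupp : ∀ (Y : (tsys d N).Dom) (i j : ι), cub j ∉ Y.1 → T Y i j = 0)
    (w : ι → ι → ℝ) (hw : ∀ i j, 0 ≤ w i j) {c₀ δ₀ : ℝ} (hc₀ : 0 ≤ c₀) (hδ₀ : kappa₀ (4 * 2 ^ d) (2 * d) ≤ δ₀)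
    (hcol : ∀ (Y : (tsys d N).Dom) (j : ι), ∑ i, ‖T Y i j‖ * w i j ≤ c₀ * Real.exp (-(δ₀ * torusTreeLen Y.1)))
    (S : Finset (tsys d N).Dom) (j : ι) :
    ∑ i, ‖(∑ Y ∈ S, T Y) i j‖ * w i j ≤ c₀ * K₀ (4 * 2 ^ d) (2 * d) := by
  classical
  calc ∑ i, ‖(∑ Y ∈ S, T Y) i j‖ * w i j
      ≤ ∑ i, (∑ Y ∈ S, ‖T Y i j‖) * w i j := by
        refine Finset.sum_le_sum fun i _ => mul_le_mul_of_nonneg_right ?_ (hw i j)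
        rw [Matrix.sum_apply]
        exact norm_sum_le _ _
    _ = ∑ Y ∈ S, ∑ i, ‖T Y i j‖ * w i j := by
        rw [Finset.sum_comm]; exact Finset.sum_congr rfl fun i _ => Finset.sum_mul _ _ _
    _ ≤ ∑ Y ∈ S, (if cub j ∈ Y.1 then c₀ * Real.exp (-(δ₀ * torusTreeLen Y.1)) else 0) := by
        refine Finset.sum_le_sum fun Y _ => ?_
        split_ifs with h
        · exact hcol Y j
        · rw [Finset.sum_eq_zero fun i _ => by rw [hsupp Y i j h, norm_zero, zero_mul]]
    _ ≤ c₀ * K₀ (4 * 2 ^ d) (2 * d) := sum_ite_mem_le (cub j) hc₀ hδ₀ S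

end Summit.QuantumFields.YangMills.Theorems.BalabanUVNodesPortS1.G3CGeom

end
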